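import Summits.AtomisticToContinuum.Crystallization.Theorems.FreeSplittingCertificatesStrictSplittingRuleP1LineTruss

/-!
# `StrictSplittingRule` (stmt-AtomisticToContinuum-12560): THE LINE TENSIONS ARE NONNEGATIVE BEYOND THE WELL — `p1Beta ≥ 0` on far legs (P1 interpolant object, part 65)

Route `FreeSplittingCertificates`, crux r3 `StrictSplittingRule` (H12⋆ = `stub_coreJointCoercive`), unit b2b-freesplit-B gen 33.
VALUE = the sign fact the far shares of the near certificate need (`hw : 0 ≤ w` with `w = ½β·χ²(midpoint)`, FAR-LEMMA-SPEC §24 (d)): the squared-length derivative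
`W′(s) = ½(s⁻⁴ − s⁻⁷)` is `≥ 0` for `s ≥ 1` (cables beyond the Lennard-Jones minimum), every node of the defining tail of a line tension is at least as far from the root as
its base node (the tail is taken on the side AWAY from the root), hence
* `ljSqDeriv_nonneg_of_one_le`;  `p1TrussTau_nonneg` — `0 ≤ τ c s d` whenever `‖V c d‖ ≥ 1`;
* **`p1Beta_nonneg_of_one_le`** — `0 ≤ β(b_q)(p−q)(s)` whenever `‖y_q − y_p‖ ≥ 1` (all legs based outside the unit ball around `p`; in particular every far leg, `R₁ = 4.05a > 1`).
NOT a proof of H12⋆, NOT summit progress.  [folklore]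
-/

noncomputable section

open scoped BigOperators Classical

namespace Summit.AtomisticToContinuum.Crystallization.Theorems.StrictSplittingRuleBirth

open Literature.MathematicalPhysics.StatisticalMechanics
open Summit.AtomisticToContinuum.Crystallization.Theorems.PalmUnimodularRigidity.LayeredLawsSelectHcp

/-- `W′(s) = ½(s⁻⁴ − s⁻⁷) ≥ 0` for `s ≥ 1`. -/
theorem ljSqDeriv_nonneg_of_one_le {s : ℝ} (hs : 1 ≤ s) : 0 ≤ ljSqDeriv s := by
  unfold ljSqDeriv
  have h0 : 0 ≤ s⁻¹ := inv_nonneg.2 (by linarith)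
  have h1 : s⁻¹ ≤ 1 := inv_le_one_of_one_le₀ hs
  have h2 : (s⁻¹) ^ 7 ≤ (s⁻¹) ^ 4 := pow_le_pow_of_le_one h0 h1 (by norm_num)
  linarith

/-- **Line tensions are nonnegative when the base node is beyond the well**: `‖V c d‖ ≥ 1 ⇒ 0 ≤ τ c s d` (`s` a stencil vector).
On the side away from the root every node `V c d ± (m+1)y_s` of the tail has `‖·‖² ≥ ‖V c d‖² ≥ 1`, so every load `W′(‖·‖²)⟪·, y_s⟫` has the sign of `±`. -/
theorem p1TrussTau_nonneg {a h : ℝ} (c : Bool) {s : ℤ × ℤ × ℤ} (hs : s ∈ p1Stencil) (d : ℤ × ℤ × ℤ)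
    (hd : 1 ≤ ‖p1TrussV a h c d‖) : 0 ≤ p1TrussTau a h c s d := by
  have hse : Even s.1 := h1_stencil_even (p1Stencil_eq ▸ hs)
  set v := p1TrussV a h c d with hv
  set e := hcpSite a h s with he
  have hline : ∀ n : ℤ, p1TrussV a h c (d + n • s) = v + (n : ℝ) • e := fun n => h1_V_line (p1TrussV_eq a h) c hse d n
  have hv1 : 1 ≤ ‖v‖ ^ 2 := by nlinarith [hd, norm_nonneg v]
  rw [p1TrussTau]
  split_ifs with hpos
  · -- outgoing tail: every term is ≥ 0
    refine tsum_nonneg fun m => ?_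
    rw [p1TrussF, hline]
    have ht : (0 : ℝ) ≤ ((m : ℤ) + 1 : ℤ) := by positivity
    have hin : 0 ≤ inner ℝ (v + (((m : ℤ) + 1 : ℤ) : ℝ) • e) e := by
      rw [inner_add_left, real_inner_smul_left, real_inner_self_eq_norm_sq]
      push_cast
      positivity
    have hsq : 1 ≤ ‖v + (((m : ℤ) + 1 : ℤ) : ℝ) • e‖ ^ 2 := by
      rw [norm_add_sq_real, real_inner_smul_right, norm_smul, Real.norm_eq_abs]
      push_cast
      rw [abs_of_nonneg (by positivity : (0 : ℝ) ≤ (m : ℝ) + 1)]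
      nlinarith [hpos, sq_nonneg (((m : ℝ) + 1) * ‖e‖)]
    exact mul_nonneg (ljSqDeriv_nonneg_of_one_le hsq) hin
  · -- incoming side: τ = −(F 0 + Σ F(−(m+1))), every term ≤ 0
    rw [not_le] at hpos
    have h0 : p1TrussF a h c s d 0 ≤ 0 := by
      rw [p1TrussF, hline]
      simp only [Int.cast_zero, zero_smul, add_zero]
      exact mul_nonpos_of_nonneg_of_nonpos (ljSqDeriv_nonneg_of_one_le hv1) hpos.le
    have hm : ∀ m : ℕ, p1TrussF a h c s d (-((m : ℤ) + 1)) ≤ 0 := by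
      intro m
      rw [p1TrussF, hline]
      have hin : inner ℝ (v + ((-((m : ℤ) + 1) : ℤ) : ℝ) • e) e ≤ 0 := by
        rw [inner_add_left, real_inner_smul_left, real_inner_self_eq_norm_sq]
        push_cast
        nlinarith [hpos, sq_nonneg ‖e‖]
      have hsq : 1 ≤ ‖v + ((-((m : ℤ) + 1) : ℤ) : ℝ) • e‖ ^ 2 := by
        rw [norm_add_sq_real, real_inner_smul_right, norm_smul, Real.norm_eq_abs]
        push_cast
        rw [show |-((m : ℝ) + 1)| = (m : ℝ) + 1 by rw [abs_neg, abs_of_nonneg (by positivity)]]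
        nlinarith [hpos, sq_nonneg (((m : ℝ) + 1) * ‖e‖)]
      exact mul_nonpos_of_nonneg_of_nonpos (ljSqDeriv_nonneg_of_one_le hsq) hin
    have ht : ∑' m : ℕ, p1TrussF a h c s d (-((m : ℤ) + 1)) ≤ 0 := tsum_nonpos hm
    linarith

/-- **The design is nonnegative on legs based beyond the well**: `‖y_q − y_p‖ ≥ 1 ⇒ 0 ≤ β(b_q)(p−q)(s)` (any `s`; zero off the stencil).
NOT a proof of H12⋆, NOT summit progress. -/
theorem p1Beta_nonneg_of_one_le {a h : ℝ} (ha : 0 < a) (hh : 0 < h) (p q s : ℤ × ℤ × ℤ) (hq : 1 ≤ ‖hcpSite a h q - hcpSite a h p‖) :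
    0 ≤ p1Beta a h (decide (Even q.1)) (p - q) s := by
  by_cases hs : s ∈ p1Stencil
  · rw [p1Beta_of_mem a h _ _ _ hs]
    have hpar : (if Even (p - q).1 then decide (Even q.1) else !decide (Even q.1)) = decide (Even p.1) := by
      show (if Even (p.1 - q.1) then _ else _) = _
      by_cases hp : Even p.1 <;> by_cases hq' : Even q.1 <;> simp [hp, hq', Int.even_sub]
    have hcov : p1TrussV a h (decide (Even p.1)) (q - p) = hcpSite a h q - hcpSite a h p := by
      have := h1_sub_eq a h p (q - p)
      rw [add_sub_cancel] at this
      rw [this, p1TrussV_eq]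
      simp
    rw [hpar, neg_sub]
    refine mul_nonneg ?_ (p1TrussTau_nonneg _ hs _ (by rw [hcov]; exact hq))
    rw [p1TrussLam_eq]
    split_ifs <;> positivity
  · rw [p1Beta_support a h _ _ _ hs]

end Summit.AtomisticToContinuum.Crystallization.Theorems.StrictSplittingRuleBirth

end
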